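import Summits.NavierStokesRegularity.NavierStokesRegularity.Theorems.SoloSalvageMagsanop2026Enstrophy
import Literature.Analysis.FluidPDE.BKMClassGradientContinuity
import Literature.Analysis.Calculus.RadialCutoff
import HarnessLib

/-!
# Crux `EfficiencyFloor.ProductionEfficiencyDecay` (stmt-NavierStokesRegularity-22866), stub
# `stub_efficiencyConcentration` (= item stmt-23111) — TOOLS: lattice covering, bounded overlap, and the
# localised Ladyzhenskaya inequality for one cut-off piece

`--supports stmt-NavierStokesRegularity-22866 --as helper` (no stub credit; consumed by
`Theorems/EfficiencyFloorProductionEfficiencyDecayEfficiencyConcentration.lean`).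

* `exists_dist_latticePt_le` — every point of `ℝ³` is within `λ` of the lattice `λℤ³`;
* `card_filter_dist_latticePt_lt_le`, `sum_indicator_ball_latticePt_le`, `sum_setIntegral_ball_latticePt_le` —
  at most `343 = 7³` lattice balls `B(λz, 3λ)` contain a given point, hence `Σ_z ∫_{B(λz,3λ)} f ≤ 343 ∫ f`;
* `piece_bound` — for `w ∈ C¹`, `w, Dw ∈ L²` and a cut-off `χ` (`0 ≤ χ ≤ 1`, `χ = 0` off `B(c,2λ)`,
  `|∇χ| ≤ M/λ`): `∫ χ⁴|w|⁴ ≤ K₆³ (∫_B |w|²)^{1/2} (2∫_B |∇w|² + 2M²λ⁻² ∫_B |w|²)^{3/2}`, `B = B(c,3λ)`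
  (Ladyzhenskaya's inequality `SobolevWholeSpace.integral_norm_pow_four_le_of_integrable` for the compactly
  supported piece `χ w`);
* `sum_rpow_three_halves_le`, `rpow_three_quarters_sq` — real-power bookkeeping.

Kinematics / calculus only; nothing about Navier–Stokes is asserted. [folklore]
-/

-- the problem directory repeats the summit name (`NavierStokesRegularity/NavierStokesRegularity`)
set_option linter.dupNamespace false

noncomputable section

open Set Filter MeasureTheory Topology Metric
open scoped InnerProductSpace ENNReal NNReal ContDiff

namespace Summit.NavierStokesRegularity.NavierStokesRegularity.Theorems

namespace ProductionEfficiencyDecay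

open Literature.Analysis.FluidPDE
open Literature.Claims.NS.Magsanop2026 (E3 vortSq gradSq)
open Literature.Claims.NS.LucardoOlivaes2026 (stretchI)
open Summit.NavierStokesRegularity.NavierStokesRegularity.Theorems.Magsanop2026Enstrophy
  (K6_nonneg slice_integrable abs_stretchI_le)

/-! ## 1. The lattice `λℤ³`: covering and bounded overlap -/

/-- **Covering**: every point of `ℝ³` is within `λ` of a lattice point (round each coordinate). [folklore] -/
theorem exists_dist_latticePt_le {lam : ℝ} (hlam : 0 < lam) {c : (Fin 3 → ℤ) → E3}
    (hc : ∀ z i, c z i = lam * (z i : ℝ)) (x : E3) :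
    ∃ z : Fin 3 → ℤ, dist x (c z) ≤ lam := by
  refine ⟨fun i => round (x i / lam), ?_⟩
  have hco : ∀ i, dist (x i) (c (fun i => round (x i / lam)) i) ^ 2 ≤ (lam / 2) ^ 2 := by
    intro i
    rw [hc, Real.dist_eq]
    have h := abs_sub_round (x i / lam)
    have hx : x i - lam * (round (x i / lam) : ℝ) = lam * (x i / lam - round (x i / lam)) := by
      field_simp
    rw [hx, abs_mul, abs_of_pos hlam]
    have h2 : lam * |x i / lam - ↑(round (x i / lam))| ≤ lam / 2 := by nlinarith [abs_nonneg (x i / lam - ↑(round (x i / lam)))]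
    exact pow_le_pow_left₀ (by positivity) h2 2
  rw [EuclideanSpace.dist_eq]
  calc Real.sqrt (∑ i, dist (x i) (c (fun i => round (x i / lam)) i) ^ 2)
      ≤ Real.sqrt (lam ^ 2) := by
        refine Real.sqrt_le_sqrt ?_
        calc ∑ i, dist (x i) (c (fun i => round (x i / lam)) i) ^ 2
            ≤ ∑ _i : Fin 3, (lam / 2) ^ 2 := Finset.sum_le_sum fun i _ => hco i
          _ = 3 * (lam / 2) ^ 2 := by simp
          _ ≤ lam ^ 2 := by nlinarith [sq_nonneg lam]
    _ = lam := Real.sqrt_sq hlam.le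

/-- **Bounded overlap**: among the lattice points, at most `343 = 7³` lie within `3λ` of a given point
(their coordinates are integers within `3` of `xᵢ/λ`). [folklore] -/
theorem card_filter_dist_latticePt_lt_le {lam : ℝ} (hlam : 0 < lam) {c : (Fin 3 → ℤ) → E3}
    (hc : ∀ z i, c z i = lam * (z i : ℝ)) (x : E3) (F : Finset (Fin 3 → ℤ)) :
    (F.filter (fun z => dist x (c z) < 3 * lam)).card ≤ 343 := by
  classical
  set box : Finset (Fin 3 → ℤ) :=
    Fintype.piFinset (fun i => Finset.Icc (⌊x i / lam⌋ - 3) (⌊x i / lam⌋ + 3)) with hbox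
  have hsub : F.filter (fun z => dist x (c z) < 3 * lam) ⊆ box := by
    intro z hz
    rw [Finset.mem_filter] at hz
    rw [hbox, Fintype.mem_piFinset]
    intro i
    rw [Finset.mem_Icc]
    have hi : dist (x i) (c z i) < 3 * lam := (PiLp.dist_apply_le x (c z) i).trans_lt hz.2
    rw [hc, Real.dist_eq] at hi
    have h' : |x i / lam - (z i : ℝ)| < 3 := by
      have hx : x i / lam - (z i : ℝ) = (x i - lam * (z i : ℝ)) / lam := by field_simp
      rw [hx, abs_div, abs_of_pos hlam, div_lt_iff₀ hlam]
      linarith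
    rw [abs_lt] at h'
    have hfl := Int.floor_le (x i / lam)
    have hlt := Int.lt_floor_add_one (x i / lam)
    constructor
    · have h3 : ((⌊x i / lam⌋ - 3 : ℤ) : ℝ) < (z i : ℝ) := by push_cast; linarith
      exact (Int.cast_lt.1 h3).le
    · have h3 : ((z i : ℤ) : ℝ) < ((⌊x i / lam⌋ + 4 : ℤ) : ℝ) := by push_cast; linarith
      have h4 := Int.cast_lt.1 h3
      omega
  calc (F.filter (fun z => dist x (c z) < 3 * lam)).card ≤ box.card :=
        Finset.card_le_card hsub
    _ = ∏ i, (Finset.Icc (⌊x i / lam⌋ - 3) (⌊x i / lam⌋ + 3)).card := by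
        rw [hbox, Fintype.card_piFinset]
    _ = 343 := by
        have h7 : ∀ i : Fin 3, (Finset.Icc (⌊x i / lam⌋ - 3) (⌊x i / lam⌋ + 3)).card = 7 := by
          intro i
          rw [Int.card_Icc]
          have : ⌊x i / lam⌋ + 3 + 1 - (⌊x i / lam⌋ - 3) = 7 := by ring
          rw [this]
          rfl
        simp [h7]

/-- Pointwise form of the bounded overlap: `Σ_{z ∈ F} 1_{B(λz,3λ)}(x) ≤ 343`. [folklore] -/
theorem sum_indicator_ball_latticePt_le {lam : ℝ} (hlam : 0 < lam) {c : (Fin 3 → ℤ) → E3}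
    (hc : ∀ z i, c z i = lam * (z i : ℝ)) (x : E3) (F : Finset (Fin 3 → ℤ)) :
    ∑ z ∈ F, (ball (c z) (3 * lam)).indicator (fun _ => (1 : ℝ)) x ≤ 343 := by
  classical
  rw [Finset.sum_indicator_eq_sum_filter F (fun _ _ => (1 : ℝ)) (fun z => ball (c z) (3 * lam))
    (fun _ => x)]
  simp only [Finset.sum_const, nsmul_eq_mul, mul_one]
  have h := card_filter_dist_latticePt_lt_le hlam hc x F
  have hset : (F.filter fun z => x ∈ ball (c z) (3 * lam)) =
      F.filter (fun z => dist x (c z) < 3 * lam) := by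
    simp only [mem_ball]
  rw [hset]
  exact_mod_cast h

/-- **Summing local integrals over the lattice balls**: for `0 ≤ f ∈ L¹`,
`Σ_{z ∈ F} ∫_{B(λz,3λ)} f ≤ 343 ∫ f`. [folklore] -/
theorem sum_setIntegral_ball_latticePt_le {lam : ℝ} (hlam : 0 < lam) {c : (Fin 3 → ℤ) → E3}
    (hc : ∀ z i, c z i = lam * (z i : ℝ)) (F : Finset (Fin 3 → ℤ))
    {f : E3 → ℝ} (hf : Integrable f) (hf0 : ∀ x, 0 ≤ f x) :
    ∑ z ∈ F, ∫ x in ball (c z) (3 * lam), f x ≤ 343 * ∫ x, f x := by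
  have hind : ∀ z ∈ F, ∫ x in ball (c z) (3 * lam), f x =
      ∫ x, (ball (c z) (3 * lam)).indicator f x := fun z _ =>
    (integral_indicator measurableSet_ball).symm
  rw [Finset.sum_congr rfl hind, ← integral_finsetSum _ fun z _ => hf.indicator measurableSet_ball,
    ← integral_const_mul]
  refine integral_mono (integrable_finsetSum _ fun z _ => hf.indicator measurableSet_ball)
    (hf.const_mul _) fun x => ?_
  have hpt : ∀ z ∈ F, (ball (c z) (3 * lam)).indicator f x =
      (ball (c z) (3 * lam)).indicator (fun _ => (1 : ℝ)) x * f x := by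
    intro z _
    by_cases hx : x ∈ ball (c z) (3 * lam)
    · simp [indicator_of_mem hx]
    · simp [indicator_of_notMem hx]
  dsimp only
  rw [Finset.sum_congr rfl hpt, ← Finset.sum_mul]
  exact mul_le_mul_of_nonneg_right (sum_indicator_ball_latticePt_le hlam hc x F) (hf0 x)

/-! ## 2. One localised piece: Ladyzhenskaya for `χ ω` -/

/-- **One localised piece.** For `w ∈ C¹` with `w, Dw ∈ L²` and a cut-off `χ ∈ C¹_c`, `0 ≤ χ ≤ 1`,
`χ = 0` off `B(c, 2λ)`, `|∇χ| ≤ M/λ`: Ladyzhenskaya's inequality for the compactly supported piece `χ w`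
gives `∫ χ⁴|w|⁴ ≤ K₆³ (∫_B |w|²)^{1/2} (2∫_B |∇w|² + 2M²λ⁻² ∫_B |w|²)^{3/2}`, `B = B(c, 3λ)`.
[cite: Evans2010, §5.6.1 Thm. 1–2] -/
theorem piece_bound {w : E3 → E3} (hw : ContDiff ℝ 1 w)
    (I2 : Integrable fun x => ‖w x‖ ^ 2) (ID : Integrable fun x => ‖fderiv ℝ w x‖ ^ 2)
    {χ : E3 → ℝ} (hχ : ContDiff ℝ 1 χ) (hχc : HasCompactSupport χ) (hχ0 : ∀ y, 0 ≤ χ y)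
    (hχ1 : ∀ y, χ y ≤ 1) {c : E3} {lam M : ℝ} (hlam : 0 < lam)
    (hzero : ∀ y, 2 * lam ≤ dist y c → χ y = 0) (hD : ∀ y, ‖fderiv ℝ χ y‖ ≤ M / lam) :
    ∫ x, χ x ^ 4 * ‖w x‖ ^ 4 ≤
      (SNormLESNormFDerivOfEqConst E3 (volume : Measure E3) 2 : ℝ) ^ 3 *
        (∫ x in ball c (3 * lam), ‖w x‖ ^ 2) ^ (1 / 2 : ℝ) *
        (2 * (∫ x in ball c (3 * lam), ‖fderiv ℝ w x‖ ^ 2) +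
          2 * (M / lam) ^ 2 * ∫ x in ball c (3 * lam), ‖w x‖ ^ 2) ^ (3 / 2 : ℝ) := by
  set B := ball c (3 * lam) with hB
  set g : E3 → E3 := fun x => χ x • w x with hg
  -- regularity and support of the piece
  have hg1 : ContDiff ℝ 1 g := hχ.smul hw
  have hgc : HasCompactSupport g := hχc.smul_right
  have cg : Continuous g := hg1.continuous
  have cDg : Continuous (fderiv ℝ g) := hg1.continuous_fderiv one_ne_zero
  have hDgc : HasCompactSupport (fderiv ℝ g) := hgc.fderiv (𝕜 := ℝ)
  have Ig : ∀ n : ℕ, n ≠ 0 → Integrable fun x => ‖g x‖ ^ n := by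
    intro n hn
    refine (cg.norm.pow n).integrable_of_hasCompactSupport (hgc.mono fun x hx => ?_)
    rw [Function.mem_support] at hx ⊢
    intro h0
    apply hx
    show ‖g x‖ ^ n = 0
    rw [h0, norm_zero, zero_pow hn]
  have IgD : Integrable fun x => ‖fderiv ℝ g x‖ ^ 2 := by
    refine (cDg.norm.pow 2).integrable_of_hasCompactSupport (hDgc.mono fun x hx => ?_)
    rw [Function.mem_support] at hx ⊢
    intro h0
    apply hx
    show ‖fderiv ℝ g x‖ ^ 2 = 0
    rw [h0, norm_zero, zero_pow two_ne_zero]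
  -- Ladyzhenskaya for the piece
  have hL := integral_norm_pow_four_le_of_integrable (volume : Measure E3) finrank_euclideanSpace_fin
    hg1 (Ig 2 two_ne_zero) (Ig 6 (by norm_num)) IgD
  -- `χ⁴ |w|⁴ = ‖g‖⁴`
  have h4 : (fun x => χ x ^ 4 * ‖w x‖ ^ 4) = fun x => ‖g x‖ ^ 4 := by
    funext x
    simp only [hg, norm_smul, Real.norm_eq_abs, abs_of_nonneg (hχ0 x), mul_pow]
  rw [h4]
  have hMl : 0 ≤ M / lam := (norm_nonneg _).trans (hD c)
  -- `‖g‖² ≤ 1_B |w|²`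
  have hg2 : ∀ x, ‖g x‖ ^ 2 ≤ B.indicator (fun x => ‖w x‖ ^ 2) x := by
    intro x
    by_cases hx : x ∈ B
    · rw [indicator_of_mem hx]
      simp only [hg, norm_smul, Real.norm_eq_abs, abs_of_nonneg (hχ0 x), mul_pow]
      have h1 : χ x ^ 2 ≤ 1 := pow_le_one₀ (hχ0 x) (hχ1 x)
      nlinarith [sq_nonneg ‖w x‖]
    · rw [indicator_of_notMem hx]
      have hdist : 2 * lam ≤ dist x c := by
        rw [hB, mem_ball, not_lt] at hx
        linarith
      simp [hg, hzero x hdist]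
  have hA : ∫ x, ‖g x‖ ^ 2 ≤ ∫ x in B, ‖w x‖ ^ 2 := by
    rw [← integral_indicator measurableSet_ball]
    exact integral_mono (Ig 2 two_ne_zero) (I2.indicator measurableSet_ball) hg2
  -- `‖Dg‖² ≤ 1_B (2‖Dw‖² + 2(M/λ)²|w|²)`
  have hDg : ∀ x, ‖fderiv ℝ g x‖ ^ 2 ≤
      B.indicator (fun x => 2 * ‖fderiv ℝ w x‖ ^ 2 + 2 * (M / lam) ^ 2 * ‖w x‖ ^ 2) x := by
    intro x
    by_cases hx : x ∈ B
    · rw [indicator_of_mem hx]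
      have hderiv : HasFDerivAt g (χ x • fderiv ℝ w x + (fderiv ℝ χ x).smulRight (w x)) x :=
        ((hχ.differentiable one_ne_zero x).hasFDerivAt.smul (hw.differentiable one_ne_zero x).hasFDerivAt)
      rw [hderiv.fderiv]
      have hn : ‖χ x • fderiv ℝ w x + (fderiv ℝ χ x).smulRight (w x)‖ ≤
          ‖fderiv ℝ w x‖ + M / lam * ‖w x‖ := by
        calc ‖χ x • fderiv ℝ w x + (fderiv ℝ χ x).smulRight (w x)‖
            ≤ ‖χ x • fderiv ℝ w x‖ + ‖(fderiv ℝ χ x).smulRight (w x)‖ := norm_add_le _ _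
          _ ≤ ‖fderiv ℝ w x‖ + M / lam * ‖w x‖ := by
              apply add_le_add
              · rw [norm_smul, Real.norm_eq_abs, abs_of_nonneg (hχ0 x)]
                exact mul_le_of_le_one_left (norm_nonneg _) (hχ1 x)
              · rw [ContinuousLinearMap.norm_smulRight_apply]
                exact mul_le_mul_of_nonneg_right (hD x) (norm_nonneg _)
      calc ‖χ x • fderiv ℝ w x + (fderiv ℝ χ x).smulRight (w x)‖ ^ 2
          ≤ (‖fderiv ℝ w x‖ + M / lam * ‖w x‖) ^ 2 := pow_le_pow_left₀ (norm_nonneg _) hn 2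
        _ ≤ 2 * ‖fderiv ℝ w x‖ ^ 2 + 2 * (M / lam) ^ 2 * ‖w x‖ ^ 2 := by
            nlinarith [sq_nonneg (‖fderiv ℝ w x‖ - M / lam * ‖w x‖)]
    · rw [indicator_of_notMem hx]
      have hdist : 3 * lam ≤ dist x c := by rwa [hB, mem_ball, not_lt] at hx
      have hev : g =ᶠ[𝓝 x] fun _ => 0 := by
        have hopen : IsOpen {y : E3 | 2 * lam < dist y c} :=
          isOpen_lt continuous_const (continuous_id.dist continuous_const)
        filter_upwards [hopen.mem_nhds (show 2 * lam < dist x c by linarith)] with y hy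
        simp [hg, hzero y (le_of_lt hy)]
      rw [hev.fderiv_eq, fderiv_const_apply]
      simp
  have hsum_int : Integrable fun x => 2 * ‖fderiv ℝ w x‖ ^ 2 + 2 * (M / lam) ^ 2 * ‖w x‖ ^ 2 :=
    (ID.const_mul 2).add (I2.const_mul _)
  have hY : ∫ x, ‖fderiv ℝ g x‖ ^ 2 ≤
      2 * (∫ x in B, ‖fderiv ℝ w x‖ ^ 2) + 2 * (M / lam) ^ 2 * ∫ x in B, ‖w x‖ ^ 2 := by
    calc ∫ x, ‖fderiv ℝ g x‖ ^ 2
        ≤ ∫ x, B.indicator (fun x => 2 * ‖fderiv ℝ w x‖ ^ 2 + 2 * (M / lam) ^ 2 * ‖w x‖ ^ 2) x :=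
          integral_mono IgD (hsum_int.indicator measurableSet_ball) hDg
      _ = ∫ x in B, (2 * ‖fderiv ℝ w x‖ ^ 2 + 2 * (M / lam) ^ 2 * ‖w x‖ ^ 2) :=
          integral_indicator measurableSet_ball
      _ = 2 * (∫ x in B, ‖fderiv ℝ w x‖ ^ 2) + 2 * (M / lam) ^ 2 * ∫ x in B, ‖w x‖ ^ 2 := by
          rw [integral_add (ID.const_mul 2).integrableOn (I2.const_mul _).integrableOn,
            integral_const_mul, integral_const_mul]
  -- monotonicity of the real powers
  have hK : 0 ≤ (SNormLESNormFDerivOfEqConst E3 (volume : Measure E3) 2 : ℝ) ^ 3 :=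
    pow_nonneg K6_nonneg 3
  have hg20 : 0 ≤ ∫ x, ‖g x‖ ^ 2 := integral_nonneg fun x => by positivity
  have hgD0 : 0 ≤ ∫ x, ‖fderiv ℝ g x‖ ^ 2 := integral_nonneg fun x => by positivity
  calc ∫ x, ‖g x‖ ^ 4
      ≤ (SNormLESNormFDerivOfEqConst E3 (volume : Measure E3) 2 : ℝ) ^ 3 *
          (∫ x, ‖g x‖ ^ 2) ^ (1 / 2 : ℝ) * (∫ x, ‖fderiv ℝ g x‖ ^ 2) ^ (3 / 2 : ℝ) := hL
    _ ≤ (SNormLESNormFDerivOfEqConst E3 (volume : Measure E3) 2 : ℝ) ^ 3 *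
          (∫ x in B, ‖w x‖ ^ 2) ^ (1 / 2 : ℝ) *
          (2 * (∫ x in B, ‖fderiv ℝ w x‖ ^ 2) + 2 * (M / lam) ^ 2 * ∫ x in B, ‖w x‖ ^ 2) ^ (3 / 2 : ℝ) := by
        have h1 : (∫ x, ‖g x‖ ^ 2) ^ (1 / 2 : ℝ) ≤ (∫ x in B, ‖w x‖ ^ 2) ^ (1 / 2 : ℝ) :=
          Real.rpow_le_rpow hg20 hA (by norm_num)
        have h2 : (∫ x, ‖fderiv ℝ g x‖ ^ 2) ^ (3 / 2 : ℝ) ≤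
            (2 * (∫ x in B, ‖fderiv ℝ w x‖ ^ 2) + 2 * (M / lam) ^ 2 * ∫ x in B, ‖w x‖ ^ 2) ^ (3 / 2 : ℝ) :=
          Real.rpow_le_rpow hgD0 hY (by norm_num)
        have h3 : 0 ≤ (∫ x, ‖g x‖ ^ 2) ^ (1 / 2 : ℝ) := Real.rpow_nonneg hg20 _
        have h4 : 0 ≤ (∫ x, ‖fderiv ℝ g x‖ ^ 2) ^ (3 / 2 : ℝ) := Real.rpow_nonneg hgD0 _
        have h5 : 0 ≤ (∫ x in B, ‖w x‖ ^ 2) ^ (1 / 2 : ℝ) :=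
          Real.rpow_nonneg (integral_nonneg fun x => by positivity) _
        calc _ ≤ (SNormLESNormFDerivOfEqConst E3 (volume : Measure E3) 2 : ℝ) ^ 3 *
              (∫ x in B, ‖w x‖ ^ 2) ^ (1 / 2 : ℝ) * (∫ x, ‖fderiv ℝ g x‖ ^ 2) ^ (3 / 2 : ℝ) := by
              gcongr
          _ ≤ _ := by gcongr

/-! ## 3. Summation bookkeeping and the concentration theorem -/

/-- `Σ_i y_i^{3/2} ≤ (Σ_i y_i)^{3/2}` for finitely many `y_i ≥ 0`. [folklore] -/
theorem sum_rpow_three_halves_le {ι : Type*} (F : Finset ι) {y : ι → ℝ} (hy : ∀ i ∈ F, 0 ≤ y i) :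
    ∑ i ∈ F, y i ^ (3 / 2 : ℝ) ≤ (∑ i ∈ F, y i) ^ (3 / 2 : ℝ) := by
  have hS : 0 ≤ ∑ i ∈ F, y i := Finset.sum_nonneg hy
  have hle : ∀ i ∈ F, y i ≤ ∑ j ∈ F, y j := fun i hi => Finset.single_le_sum hy hi
  have hsplit : ∀ {t : ℝ}, 0 ≤ t → t ^ (3 / 2 : ℝ) = t * t ^ (1 / 2 : ℝ) := fun {t} ht => by
    rw [show (3 / 2 : ℝ) = 1 + 1 / 2 by norm_num, Real.rpow_add' ht (by norm_num), Real.rpow_one]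
  calc ∑ i ∈ F, y i ^ (3 / 2 : ℝ) = ∑ i ∈ F, y i * y i ^ (1 / 2 : ℝ) :=
        Finset.sum_congr rfl fun i hi => hsplit (hy i hi)
    _ ≤ ∑ i ∈ F, y i * (∑ j ∈ F, y j) ^ (1 / 2 : ℝ) := Finset.sum_le_sum fun i hi =>
        mul_le_mul_of_nonneg_left (Real.rpow_le_rpow (hy i hi) (hle i hi) (by norm_num)) (hy i hi)
    _ = (∑ i ∈ F, y i) * (∑ j ∈ F, y j) ^ (1 / 2 : ℝ) := by rw [Finset.sum_mul]
    _ = (∑ i ∈ F, y i) ^ (3 / 2 : ℝ) := (hsplit hS).symm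

/-- `(t^{3/4})² = t^{3/2}` for `t ≥ 0`. [folklore] -/
theorem rpow_three_quarters_sq {t : ℝ} (ht : 0 ≤ t) : (t ^ (3 / 4 : ℝ)) ^ 2 = t ^ (3 / 2 : ℝ) := by
  rw [← Real.rpow_natCast, ← Real.rpow_mul ht]
  norm_num

end ProductionEfficiencyDecay

end Summit.NavierStokesRegularity.NavierStokesRegularity.Theorems

end
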